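import Summits.BirchSwinnertonDyer.Rank1Residual.Additive.X4SharpThreeKimConjectureEndState
import Summits.BirchSwinnertonDyer.Rank1Residual.Additive.QuadraticTwistBSDComparisonIsogeny
import HarnessLib

/-!
# Kim's Conjecture 1.10 at `p ≥ 3` on 3-adic-tower rows is an ISOGENY INVARIANT modulo the announced
# Kim 2025 clause; transport from a CLOSED isogenous curve (cell `b2b-bsdres`, seat additive-p4 gen 17,
# line V32b; the `p = 3` twin of `X4/KimConjectureIsogenyOptimal.lean` §1; CLASS-CLOSURE §3.1 N11, E3)

HONEST FRAMING (cell `b2b-bsdres`, run/shared/lean/b2b/bsd-rank1-residual/, verbatim in every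
file): the goal of the cell is to DELETE the COMBINATION-SHAPED residual classes of the
Birch–Swinnerton-Dyer formula for ALL analytic-rank `≤ 1` elliptic curves over `ℚ` — "full BSD
formula for every rank `≤ 1` curve in class `C`" assembled STRICTLY from published theorems — so
that the rank-`≤ 1` remainder becomes exactly the CONSTRUCTION-SHAPED classes, which are TYPED
(missing-input `Prop`s), NOT attempted. This is not "finishing BSD". Sub-cell additive-p4 (X3♯/X4♯
direct): research route on the CONSTRUCTION-SHAPED class X4; the label X4 and the mark of
RESIDUAL-MAP §I N11 are UNCHANGED; nothing is booked. Theorems only (no definition, no named fact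
minted). EVERY theorem below is CONDITIONAL on the UNREFEREED PREPRINT binder `hK25s` =
`Kim2025.thm11_kimShaLength_of_integralPeriod_OPEN` (flag `Kim2025-preprint`) and takes Cassels'
isogeny invariance as the named fact `hCassels = bsdRHS_eq_of_isIsogenous`, GZK `hGZK`, modularity
`hmod`. Kim's Conjecture 1.10 appears only as the typed predicate `X4.KimTamagawaDefectAt`.

## What this file proves

* `kimTamagawaDefectAt_iff_of_isIsogenous_of_kim2025_OPEN`: for `ℚ`-isogenous globally minimal
  `W ∼ W'`, analytic rank `0`, `p ≥ 3`, the `p`-adic TOWER on both sides, admissible₃ data `D`, `D'`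
  (period transfer + `Ω⁺_f`-integral plus symbols) on both sides: Conjecture 1.10 holds at
  `(W, p, D.f)` iff at `(W', p, D'.f)` — the sibling's (`Additive/X4SharpThreeKimConjectureEndState`)
  `bsdp_iff_kimTamagawaDefectAt_of_kim2025_OPEN` on both sides + the kernel Cassels
  `TwistComparison.bsdp_iff_bsdp_of_isIsogenous`. Halves likewise.
* `kimTamagawaDefectAt_of_bsdp_isogenous_of_kim2025_OPEN`: `BSD(W', p)` for ANY isogenous `W'`
  (closed by any route; no datum, no tower needed on `W'`) gives the conjecture at `(W, p, D.f)`.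
Consequence for the N11 census (KURX@3, E1/E4): modulo the preprint, Conjecture 1.10 at `3` may be
tested / calibrated on ONE tower curve per isogeny class. Nothing booked; N11's mark UNCHANGED.

References: Kim 2025 [Kim2025RefinedTNC] Thm. 1.1 (PRE); Kim 2026 [Kim2022StructureSelmer] Conj. 1.10;
Cassels 1965 [Cassels1965ArithmeticVIII]; Miller 2011 [Miller2011LMS] §1, Def. 1.1.
-/

noncomputable section

open scoped Classical MatrixGroups ModularForm

open CongruenceSubgroup WeierstrassCurve Literature.NumberTheory.EllipticCurves
  Literature.NumberTheory.EllipticCurves.ModularForms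
  Literature.NumberTheory.EllipticCurves.Rank1Residual
  Literature.NumberTheory.EllipticCurves.Rank1Residual.Typed

namespace Summit.BirchSwinnertonDyer.Rank1Residual.Additive

variable (W W' : WeierstrassCurve ℚ) [W.IsElliptic] [W.IsGloballyMinimal] [W'.IsElliptic]
  [W'.IsGloballyMinimal] (p : ℕ) [Fact p.Prime]

/-- **Conjecture 1.10 at `p ≥ 3` on tower rows is an ISOGENY INVARIANT, CONDITIONAL on the
preprint** (`hK25s`, flag `Kim2025-preprint`): `ℚ`-isogenous globally minimal `W ∼ W'`, analytic
rank `0`, `ρ̄_{·,p^n}` onto for all `n` on both sides, admissible₃ data on both sides ⟹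
`X4.KimTamagawaDefectAt W p D.f ↔ X4.KimTamagawaDefectAt W' p D'.f`.
[claim: Kim2025RefinedTNC, status: under-review]
[cite: Kim2025RefinedTNC, Thm. 1.1 ("BSD") (ANNOUNCED, OPEN binder)] [cite: Kim2022StructureSelmer, Conj. 1.10 (PDF p. 8)]
[cite: Cassels1965ArithmeticVIII] [cite: Miller2011LMS, §1 and Def. 1.1] -/
theorem kimTamagawaDefectAt_iff_of_isIsogenous_of_kim2025_OPEN
    (hK25s : Kim2025.thm11_kimShaLength_of_integralPeriod_OPEN) (hCassels : bsdRHS_eq_of_isIsogenous)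
    (hGZK : rank_eq_analyticRank_of_analyticRank_le_one) (hmod : hasEntireLFunction_rat)
    (hiso : IsIsogenous W W') (hp3 : 3 ≤ p) (hr : W.analyticRank = 0)
    (htower : ∀ n : ℕ, W.HasSurjectiveModNGaloisRep (p ^ n : ℕ))
    (htower' : ∀ n : ℕ, W'.HasSurjectiveModNGaloisRep (p ^ n : ℕ))
    {N : ℕ} [NeZero N] (D : ModularParametrizationData W N)
    (hper : ∃ u : ℚ, ‖(u : ℚ_[p])‖ = 1 ∧ W.realPeriodRat = u * plusPeriod D.f)
    (hint : ∀ r : ℚ, ratPlusSymbol D.f r ≠ 0 → 0 ≤ padicValRat p (ratPlusSymbol D.f r))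
    {N' : ℕ} [NeZero N'] (D' : ModularParametrizationData W' N')
    (hper' : ∃ u : ℚ, ‖(u : ℚ_[p])‖ = 1 ∧ W'.realPeriodRat = u * plusPeriod D'.f)
    (hint' : ∀ r : ℚ, ratPlusSymbol D'.f r ≠ 0 → 0 ≤ padicValRat p (ratPlusSymbol D'.f r)) :
    X4.KimTamagawaDefectAt W p D.f ↔ X4.KimTamagawaDefectAt W' p D'.f := by
  have hr' : W'.analyticRank = 0 := by rw [← analyticRank_eq_of_isIsogenous' hiso]; exact hr
  rw [← bsdp_iff_kimTamagawaDefectAt_of_kim2025_OPEN W p hK25s hGZK hmod hp3 hr htower D hper hint,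
    ← bsdp_iff_kimTamagawaDefectAt_of_kim2025_OPEN W' p hK25s hGZK hmod hp3 hr' htower' D' hper' hint']
  exact TwistComparison.bsdp_iff_bsdp_of_isIsogenous W W' p hCassels hGZK hmod hiso
    (by rw [hr]; exact zero_le_one)

/-- **The `≤` half at `p ≥ 3` on tower rows is an isogeny invariant, CONDITIONAL on the preprint.**
[claim: Kim2025RefinedTNC, status: under-review]
[cite: Kim2025RefinedTNC, Thm. 1.1 ("BSD") (ANNOUNCED, OPEN binder)] [cite: Cassels1965ArithmeticVIII] [cite: Miller2011LMS, Def. 1.1] -/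
theorem kimTamagawaDefectLeAt_iff_of_isIsogenous_of_kim2025_OPEN
    (hK25s : Kim2025.thm11_kimShaLength_of_integralPeriod_OPEN) (hCassels : bsdRHS_eq_of_isIsogenous)
    (hGZK : rank_eq_analyticRank_of_analyticRank_le_one) (hmod : hasEntireLFunction_rat)
    (hiso : IsIsogenous W W') (hp3 : 3 ≤ p) (hr : W.analyticRank = 0)
    (htower : ∀ n : ℕ, W.HasSurjectiveModNGaloisRep (p ^ n : ℕ))
    (htower' : ∀ n : ℕ, W'.HasSurjectiveModNGaloisRep (p ^ n : ℕ))
    {N : ℕ} [NeZero N] (D : ModularParametrizationData W N)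
    (hper : ∃ u : ℚ, ‖(u : ℚ_[p])‖ = 1 ∧ W.realPeriodRat = u * plusPeriod D.f)
    (hint : ∀ r : ℚ, ratPlusSymbol D.f r ≠ 0 → 0 ≤ padicValRat p (ratPlusSymbol D.f r))
    {N' : ℕ} [NeZero N'] (D' : ModularParametrizationData W' N')
    (hper' : ∃ u : ℚ, ‖(u : ℚ_[p])‖ = 1 ∧ W'.realPeriodRat = u * plusPeriod D'.f)
    (hint' : ∀ r : ℚ, ratPlusSymbol D'.f r ≠ 0 → 0 ≤ padicValRat p (ratPlusSymbol D'.f r)) :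
    X4.KimTamagawaDefectLeAt W p D.f ↔ X4.KimTamagawaDefectLeAt W' p D'.f := by
  have hr' : W'.analyticRank = 0 := by rw [← analyticRank_eq_of_isIsogenous' hiso]; exact hr
  rw [← missingLowerBoundAt_iff_kimTamagawaDefectLeAt_of_kim2025_OPEN W p hK25s hGZK hmod hp3 hr htower
      D hper hint,
    ← missingLowerBoundAt_iff_kimTamagawaDefectLeAt_of_kim2025_OPEN W' p hK25s hGZK hmod hp3 hr'
      htower' D' hper' hint']
  exact ⟨TwistComparison.missingLowerBoundAt_of_isIsogenous W W' p hCassels hGZK hmod hiso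
      (by rw [hr]; exact zero_le_one),
    TwistComparison.missingLowerBoundAt_of_isIsogenous W' W p hCassels hGZK hmod hiso.symm_of_isElliptic
      (by rw [hr']; exact zero_le_one)⟩

/-- **The `≥` half at `p ≥ 3` on tower rows is an isogeny invariant, CONDITIONAL on the preprint.**
[claim: Kim2025RefinedTNC, status: under-review]
[cite: Kim2025RefinedTNC, Thm. 1.1 ("BSD") (ANNOUNCED, OPEN binder)] [cite: Cassels1965ArithmeticVIII] [cite: Miller2011LMS, Def. 1.1] -/
theorem kimTamagawaDefectGeAt_iff_of_isIsogenous_of_kim2025_OPEN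
    (hK25s : Kim2025.thm11_kimShaLength_of_integralPeriod_OPEN) (hCassels : bsdRHS_eq_of_isIsogenous)
    (hGZK : rank_eq_analyticRank_of_analyticRank_le_one) (hmod : hasEntireLFunction_rat)
    (hiso : IsIsogenous W W') (hp3 : 3 ≤ p) (hr : W.analyticRank = 0)
    (htower : ∀ n : ℕ, W.HasSurjectiveModNGaloisRep (p ^ n : ℕ))
    (htower' : ∀ n : ℕ, W'.HasSurjectiveModNGaloisRep (p ^ n : ℕ))
    {N : ℕ} [NeZero N] (D : ModularParametrizationData W N)
    (hper : ∃ u : ℚ, ‖(u : ℚ_[p])‖ = 1 ∧ W.realPeriodRat = u * plusPeriod D.f)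
    (hint : ∀ r : ℚ, ratPlusSymbol D.f r ≠ 0 → 0 ≤ padicValRat p (ratPlusSymbol D.f r))
    {N' : ℕ} [NeZero N'] (D' : ModularParametrizationData W' N')
    (hper' : ∃ u : ℚ, ‖(u : ℚ_[p])‖ = 1 ∧ W'.realPeriodRat = u * plusPeriod D'.f)
    (hint' : ∀ r : ℚ, ratPlusSymbol D'.f r ≠ 0 → 0 ≤ padicValRat p (ratPlusSymbol D'.f r)) :
    X4.KimTamagawaDefectGeAt W p D.f ↔ X4.KimTamagawaDefectGeAt W' p D'.f := by
  have hr' : W'.analyticRank = 0 := by rw [← analyticRank_eq_of_isIsogenous' hiso]; exact hr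
  rw [← missingUpperBoundAt_iff_kimTamagawaDefectGeAt_of_kim2025_OPEN W p hK25s hGZK hmod hp3 hr htower
      D hper hint,
    ← missingUpperBoundAt_iff_kimTamagawaDefectGeAt_of_kim2025_OPEN W' p hK25s hGZK hmod hp3 hr'
      htower' D' hper' hint']
  exact ⟨TwistComparison.missingUpperBoundAt_of_isIsogenous W W' p hCassels hGZK hmod hiso
      (by rw [hr]; exact zero_le_one),
    TwistComparison.missingUpperBoundAt_of_isIsogenous W' W p hCassels hGZK hmod hiso.symm_of_isElliptic
      (by rw [hr']; exact zero_le_one)⟩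

/-- **Transport from a CLOSED isogenous curve at `p ≥ 3`, CONDITIONAL on the preprint**: `W'`
`ℚ`-isogenous to `W` with `BSD(W', p)` of record (any route; no datum or tower needed on `W'`) ⟹
Conjecture 1.10 at `(W, p, D.f)` for every admissible₃ datum `D` of the tower row `W`
(analytic rank `0`). [claim: Kim2025RefinedTNC, status: under-review]
[cite: Kim2025RefinedTNC, Thm. 1.1 ("BSD") (ANNOUNCED, OPEN binder)] [cite: Cassels1965ArithmeticVIII] [cite: Miller2011LMS, §1 and Def. 1.1] -/
theorem kimTamagawaDefectAt_of_bsdp_isogenous_of_kim2025_OPEN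
    (hK25s : Kim2025.thm11_kimShaLength_of_integralPeriod_OPEN) (hCassels : bsdRHS_eq_of_isIsogenous)
    (hGZK : rank_eq_analyticRank_of_analyticRank_le_one) (hmod : hasEntireLFunction_rat)
    (hiso : IsIsogenous W' W) (hp3 : 3 ≤ p) (hr : W.analyticRank = 0)
    (htower : ∀ n : ℕ, W.HasSurjectiveModNGaloisRep (p ^ n : ℕ))
    {N : ℕ} [NeZero N] (D : ModularParametrizationData W N)
    (hper : ∃ u : ℚ, ‖(u : ℚ_[p])‖ = 1 ∧ W.realPeriodRat = u * plusPeriod D.f)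
    (hint : ∀ r : ℚ, ratPlusSymbol D.f r ≠ 0 → 0 ≤ padicValRat p (ratPlusSymbol D.f r))
    (h' : BSDp W' p) : X4.KimTamagawaDefectAt W p D.f := by
  have hr' : W'.analyticRank ≤ 1 := by
    rw [analyticRank_eq_of_isIsogenous' hiso, hr]; exact zero_le_one
  exact (bsdp_iff_kimTamagawaDefectAt_of_kim2025_OPEN W p hK25s hGZK hmod hp3 hr htower D hper hint).mp
    (TwistComparison.bsdp_of_bsdp_of_isIsogenous W' W p hCassels hGZK hmod hiso hr' h')

end Summit.BirchSwinnertonDyer.Rank1Residual.Additive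

end
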